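import Literature.Topology.FourManifolds.SmoothOrientation
import Mathlib.LinearAlgebra.Alternating.Curry
import HarnessLib

/-!
# Spheres are orientable: proof of the named fact `Literature.Topology.FourManifolds.isOrientable_sphere`

Sibling proof file of `SmoothOrientation.lean` (D-0014: named facts `def X : Prop` are discharged
as `theorem X_holds : X`). It discharges

* `Literature.isOrientable_sphere_holds : isOrientable_sphere` — every sphere
  `𝕊ⁿ = Metric.sphere (0 : EuclideanSpace ℝ (Fin (n + 1))) 1`, `n : ℕ`, carries a smooth
  orientation `Literature.SmoothOrientation (𝓡 n) 𝕊ⁿ`,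

through the explicit **standard orientation** of `𝕊ⁿ` (`Literature.Topology.FourManifolds.exists_smoothOrientation_sphere`).

## Source

M. W. Hirsch, *Differential Topology*, GTM 33, Springer (1976):

* §4.4, p. 100–101: a manifold is orientable iff its tangent bundle is, iff it has an atlas with
  positive Jacobians; "`Sⁿ = ∂Dⁿ⁺¹`" is oriented as the boundary of the disc, and a linear
  `L ∈ O(n + 1)` preserves this orientation of `Sⁿ` iff `det L > 0`;
* §5.1, p. 115: the *standard orientation* of `Sⁿ` is the boundary orientation of `Dⁿ⁺¹`
  ("outward normal first").

## Proof

A basis `(v₁, …, vₙ)` of `T_x 𝕊ⁿ = xᗮ ⊂ ℝⁿ⁺¹` is positive for the boundary orientation iff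
`det[x, v₁, …, vₙ] > 0` (outward normal `x` first). Mathlib's chart of `𝕊ⁿ` at `x` is the
stereographic projection `stereographic' n (-x)` from the antipode followed by an *arbitrary* linear
isometry `(ℝ ∙ (-x))ᗮ ≃ₗᵢ EuclideanSpace ℝ (Fin n)`; every point has its own chart, with
uncontrolled Jacobian signs. In the language of `Literature.Topology.FourManifolds.SmoothOrientation` (an orientation of the model
space at each point, read in the preferred chart there, locally constant up to the sign of the
Jacobian of the chart change) the standard orientation is therefore: with `σₓ` the chart at `x`,
`σₓ⁻¹ : EuclideanSpace ℝ (Fin n) → ℝⁿ⁺¹` its inverse followed by the inclusion, and the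
**frame determinant** `Φₓ(q) = det[σₓ⁻¹ q, D(σₓ⁻¹)(q) e₁, …, D(σₓ⁻¹)(q) eₙ]`, take at `x` the standard
orientation of `EuclideanSpace ℝ (Fin n)` if `Φₓ(σₓ x) > 0` and its opposite otherwise. Local
constancy follows from

1. `Φₓ(σₓ x) ≠ 0`: `D(σₓ⁻¹)(σₓ x) = mfderiv val x` is injective with range `xᗮ ∌ x`
   (Mathlib `mfderiv_coe_sphere_injective`, `range_mfderiv_coe_sphere`);
2. continuity of `Φₓ` (`σₓ⁻¹` is `C¹`, Mathlib `contMDiff_coe_sphere`), so `Φₓ(σₓ y)` has the sign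
   of `Φₓ(σₓ x)` for `y` near `x`;
3. the chain rule `D(σ_y⁻¹)(σ_y y) = D(σₓ⁻¹)(σₓ y) ∘ T`, `T = tangentCoordChange (𝓡 n) y x y`;
4. the scaling `Φ_y(σ_y y) = det T · Φₓ(σₓ y)`: `v ↦ det[p, A v₁, …, A vₙ]` is an alternating
   `n`-form on the `n`-dimensional model space (`AlternatingMap.eq_smul_basis_det`);
5. `det T ≠ 0` (cocycle identity `tangentCoordChange_comp`/`tangentCoordChange_self`).

Design: this file only adds theorems (no auxiliary definitions, notation or local instances); the
frame determinant is threaded through the auxiliary lemmas as a function `Φ` together with its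
defining equation `hΦ`, and Mathlib's `Fact (finrank ℝ (EuclideanSpace ℝ (Fin (n + 1))) = n + 1)`,
consumed by its sphere API, is supplied inside the proofs by `haveI`, exactly as Mathlib does in
`EuclideanSpace.instIsManifoldSphere`.
-/

open scoped Manifold ContDiff Topology
open Set Module Metric

namespace Literature.Topology.FourManifolds

namespace SmoothOrientation.Sphere

/-! #### Linear algebra: the "outward normal first" determinant -/

/-- Scaling of the "normal first" determinant under a change of frame: for bases `B` of `M`
(size `k + 1`) and `b` of `N` (size `k`), a point `p : M` and linear maps `A : N → M`, `T : N → N`,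
`det_B[p, A T b₁, …, A T bₖ] = det T · det_B[p, A b₁, …, A bₖ]`, because
`v ↦ det_B[p, A v₁, …, A vₖ]` is an alternating `k`-form on `N` (`AlternatingMap.eq_smul_basis_det`).
[folklore] -/
theorem det_cons_comp_eq_det_mul {R : Type*} [CommRing R] {M N : Type*} [AddCommGroup M]
    [Module R M] [TopologicalSpace M] [AddCommGroup N] [Module R N] [TopologicalSpace N] {k : ℕ}
    (B : Basis (Fin (k + 1)) R M) (b : Basis (Fin k) R N) (p : M) (A : N →L[R] M)
    (T : N →L[R] N) :
    B.det (Fin.cons p fun i => (A.comp T) (b i)) =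
      LinearMap.det (T : N →ₗ[R] N) * B.det (Fin.cons p fun i => A (b i)) := by
  let al : N [⋀^Fin k]→ₗ[R] R :=
    (AlternatingMap.curryLeft B.det p).compLinearMap (A : N →ₗ[R] M)
  have hal : ∀ v : Fin k → N, al v = B.det (Fin.cons p fun i => A (v i)) := fun v => rfl
  have key := al.eq_smul_basis_det b
  calc B.det (Fin.cons p fun i => (A.comp T) (b i))
      = al (⇑(T : N →ₗ[R] N) ∘ ⇑b) := (hal _).symm
    _ = (al b • b.det) (⇑(T : N →ₗ[R] N) ∘ ⇑b) := by rw [← key]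
    _ = LinearMap.det (T : N →ₗ[R] N) * al b := by
        rw [AlternatingMap.smul_apply, Basis.det_comp, Basis.det_self, mul_one, smul_eq_mul,
          mul_comm]
    _ = LinearMap.det (T : N →ₗ[R] N) * B.det (Fin.cons p fun i => A (b i)) := by rw [hal]

/-- The determinant in the standard basis of `EuclideanSpace ℝ (Fin k)` is a continuous function of
the `k` vectors (a polynomial in their coordinates). [folklore] -/
theorem continuous_basisFun_det (k : ℕ) :
    Continuous fun v : Fin k → EuclideanSpace ℝ (Fin k) =>
      (EuclideanSpace.basisFun (Fin k) ℝ).toBasis.det v := by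
  simp_rw [Basis.det_apply]
  refine Continuous.matrix_det (continuous_matrix fun i j => ?_)
  simp only [Basis.toMatrix_apply, OrthonormalBasis.coe_toBasis_repr_apply,
    EuclideanSpace.basisFun_repr]
  fun_prop

variable {n : ℕ}

/-- If `L : ℝⁿ →L ℝⁿ⁺¹` is injective with range `xᗮ` for a unit vector `x`, then
`det[x, L e₁, …, L eₙ] ≠ 0` (standard bases): the family `(x, L e₁, …, L eₙ)` is linearly
independent since `x ∉ xᗮ`. Applied below to `L = mfderiv val x`, the differential of the inclusion
`𝕊ⁿ → ℝⁿ⁺¹` (Mathlib `mfderiv_coe_sphere_injective`, `range_mfderiv_coe_sphere`). [folklore] -/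
theorem basisFun_det_cons_ne_zero (x : sphere (0 : EuclideanSpace ℝ (Fin (n + 1))) 1)
    (L : EuclideanSpace ℝ (Fin n) →L[ℝ] EuclideanSpace ℝ (Fin (n + 1)))
    (hinj : Function.Injective L)
    (hrange : LinearMap.range (L : EuclideanSpace ℝ (Fin n) →ₗ[ℝ] EuclideanSpace ℝ (Fin (n + 1))) =
      (ℝ ∙ (x : EuclideanSpace ℝ (Fin (n + 1))))ᗮ) :
    (EuclideanSpace.basisFun (Fin (n + 1)) ℝ).toBasis.det
      (Fin.cons (x : EuclideanSpace ℝ (Fin (n + 1)))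
        fun i => L ((EuclideanSpace.basisFun (Fin n) ℝ).toBasis i)) ≠ 0 := by
  have hli : LinearIndependent ℝ (Fin.cons (x : EuclideanSpace ℝ (Fin (n + 1)))
      fun i => L ((EuclideanSpace.basisFun (Fin n) ℝ).toBasis i)) := by
    rw [linearIndependent_finCons]
    refine ⟨?_, fun hx => ?_⟩
    · exact (EuclideanSpace.basisFun (Fin n) ℝ).toBasis.linearIndependent.map'
        (L : EuclideanSpace ℝ (Fin n) →ₗ[ℝ] EuclideanSpace ℝ (Fin (n + 1)))
        (LinearMap.ker_eq_bot.2 hinj)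
    · have hmem : (x : EuclideanSpace ℝ (Fin (n + 1))) ∈
          (ℝ ∙ (x : EuclideanSpace ℝ (Fin (n + 1))))ᗮ := by
        rw [← hrange]
        refine (Submodule.span_le.2 ?_) hx
        rintro _ ⟨i, rfl⟩
        exact LinearMap.mem_range_self _ _
      have h0 : inner ℝ (x : EuclideanSpace ℝ (Fin (n + 1))) (x : EuclideanSpace ℝ (Fin (n + 1))) =
          0 :=
        Submodule.inner_right_of_mem_orthogonal (Submodule.mem_span_singleton_self _) hmem
      have h1 : ‖(x : EuclideanSpace ℝ (Fin (n + 1)))‖ = 1 := norm_eq_of_mem_sphere x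
      rw [real_inner_self_eq_norm_sq, h1] at h0
      norm_num at h0
  have hcard : Fintype.card (Fin (n + 1)) = finrank ℝ (EuclideanSpace ℝ (Fin (n + 1))) := by simp
  have hu := (EuclideanSpace.basisFun (Fin (n + 1)) ℝ).toBasis.isUnit_det
    (basisOfLinearIndependentOfCardEqFinrank hli hcard)
  rw [coe_basisOfLinearIndependentOfCardEqFinrank] at hu
  exact hu.ne_zero

/-! #### The stereographic charts of `𝕊ⁿ` -/

/-- The stereographic charts of `𝕊ⁿ` are onto `EuclideanSpace ℝ (Fin n)`
(Mathlib `stereographic'_target`). [folklore] -/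
theorem chartAt_target (x : sphere (0 : EuclideanSpace ℝ (Fin (n + 1))) 1) :
    (chartAt (EuclideanSpace ℝ (Fin n)) x).target = univ :=
  haveI : Fact (finrank ℝ (EuclideanSpace ℝ (Fin (n + 1))) = n + 1) := ⟨finrank_euclideanSpace_fin⟩
  stereographic'_target (-x)

/-- The inverse `σₓ⁻¹` of the chart of `𝕊ⁿ` at `x` (stereographic projection from `-x`), followed by
the inclusion into `ℝⁿ⁺¹`, is `C¹` on all of `EuclideanSpace ℝ (Fin n)`: this is
`contMDiff_coe_sphere` read in the chart at `x` (Hirsch, *Differential Topology*, §1.1). [folklore] -/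
theorem contDiff_coe_comp_chartAt_symm (x : sphere (0 : EuclideanSpace ℝ (Fin (n + 1))) 1) :
    ContDiff ℝ 1 (Subtype.val ∘ (chartAt (EuclideanSpace ℝ (Fin n)) x).symm :
      EuclideanSpace ℝ (Fin n) → EuclideanSpace ℝ (Fin (n + 1))) := by
  haveI : Fact (finrank ℝ (EuclideanSpace ℝ (Fin (n + 1))) = n + 1) := ⟨finrank_euclideanSpace_fin⟩
  have h := (contMDiff_iff.1 (contMDiff_coe_sphere (m := 1) (n := n)
    (E := EuclideanSpace ℝ (Fin (n + 1))))).2 x x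
  simp only [mfld_simps] at h
  rw [chartAt_target, contDiffOn_univ] at h
  exact h

/-- The differential of the inclusion `𝕊ⁿ → ℝⁿ⁺¹` at `x`, in the preferred chart at `x`, is the
derivative of `σₓ⁻¹` at `σₓ x` (definition of `mfderiv`, the target chart being the identity; as in
Mathlib's `range_mfderiv_coe_sphere` the tangent spaces of the model spaces are identified with the
model spaces). [folklore] -/
theorem mfderiv_coe_sphere_eq_fderiv (x : sphere (0 : EuclideanSpace ℝ (Fin (n + 1))) 1) :
    (mfderiv (𝓡 n) 𝓘(ℝ, EuclideanSpace ℝ (Fin (n + 1)))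
        (Subtype.val : sphere (0 : EuclideanSpace ℝ (Fin (n + 1))) 1 → EuclideanSpace ℝ (Fin (n + 1)))
        x : EuclideanSpace ℝ (Fin n) →L[ℝ] EuclideanSpace ℝ (Fin (n + 1))) =
      fderiv ℝ (Subtype.val ∘ (chartAt (EuclideanSpace ℝ (Fin n)) x).symm)
        (chartAt (EuclideanSpace ℝ (Fin n)) x x) := by
  haveI : Fact (finrank ℝ (EuclideanSpace ℝ (Fin (n + 1))) = n + 1) := ⟨finrank_euclideanSpace_fin⟩
  rw [((contMDiff_coe_sphere x).mdifferentiableAt one_ne_zero).mfderiv]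
  simp only [fderivWithin_univ, mfld_simps]

/-- The chain rule for the inverse charts, step (3): for `y` in the chart domain of `x`,
`D(σ_y⁻¹)(σ_y y) = D(σₓ⁻¹)(σₓ y) ∘ T` with `T = tangentCoordChange (𝓡 n) y x y` the derivative at
`σ_y y` of the chart change `σₓ ∘ σ_y⁻¹`, because `σₓ⁻¹ ∘ (σₓ ∘ σ_y⁻¹) = σ_y⁻¹` near `σ_y y`
(Hirsch, *Differential Topology*, §1.1). [folklore] -/
theorem fderiv_coe_comp_chartAt_symm_eq_comp {x y : sphere (0 : EuclideanSpace ℝ (Fin (n + 1))) 1}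
    (hy : y ∈ (chartAt (EuclideanSpace ℝ (Fin n)) x).source) :
    fderiv ℝ (Subtype.val ∘ (chartAt (EuclideanSpace ℝ (Fin n)) y).symm)
        (chartAt (EuclideanSpace ℝ (Fin n)) y y) =
      (fderiv ℝ (Subtype.val ∘ (chartAt (EuclideanSpace ℝ (Fin n)) x).symm)
        (chartAt (EuclideanSpace ℝ (Fin n)) x y)).comp (tangentCoordChange (𝓡 n) y x y) := by
  have h1 : HasFDerivAt
      ((chartAt (EuclideanSpace ℝ (Fin n)) x) ∘ (chartAt (EuclideanSpace ℝ (Fin n)) y).symm)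
      (tangentCoordChange (𝓡 n) y x y) (chartAt (EuclideanSpace ℝ (Fin n)) y y) := by
    have := hasFDerivWithinAt_tangentCoordChange (I := 𝓡 n) (x := y) (y := x) (z := y)
      ⟨by simp, by simpa using hy⟩
    simpa [hasFDerivWithinAt_univ] using this
  have h2 : HasFDerivAt (Subtype.val ∘ (chartAt (EuclideanSpace ℝ (Fin n)) x).symm)
      (fderiv ℝ (Subtype.val ∘ (chartAt (EuclideanSpace ℝ (Fin n)) x).symm)
        (chartAt (EuclideanSpace ℝ (Fin n)) x y))
      (((chartAt (EuclideanSpace ℝ (Fin n)) x) ∘ (chartAt (EuclideanSpace ℝ (Fin n)) y).symm)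
        (chartAt (EuclideanSpace ℝ (Fin n)) y y)) := by
    rw [Function.comp_apply, (chartAt (EuclideanSpace ℝ (Fin n)) y).left_inv (mem_chart_source _ y)]
    exact (((contDiff_coe_comp_chartAt_symm x).differentiable one_ne_zero) _).hasFDerivAt
  have h3 := h2.comp _ h1
  have h4 : (Subtype.val ∘ (chartAt (EuclideanSpace ℝ (Fin n)) x).symm) ∘
        ((chartAt (EuclideanSpace ℝ (Fin n)) x) ∘ (chartAt (EuclideanSpace ℝ (Fin n)) y).symm)
      =ᶠ[𝓝 (chartAt (EuclideanSpace ℝ (Fin n)) y y)]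
        (Subtype.val ∘ (chartAt (EuclideanSpace ℝ (Fin n)) y).symm) := by
    have : ∀ᶠ q in 𝓝 (chartAt (EuclideanSpace ℝ (Fin n)) y y),
        (chartAt (EuclideanSpace ℝ (Fin n)) y).symm q ∈
          (chartAt (EuclideanSpace ℝ (Fin n)) x).source := by
      refine ((chartAt (EuclideanSpace ℝ (Fin n)) y).continuousAt_symm
        (mem_chart_target _ y)).preimage_mem_nhds ?_
      rw [(chartAt (EuclideanSpace ℝ (Fin n)) y).left_inv (mem_chart_source _ y)]
      exact (chartAt (EuclideanSpace ℝ (Fin n)) x).open_source.mem_nhds hy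
    filter_upwards [this] with q hq
    simp only [Function.comp_apply]
    rw [(chartAt (EuclideanSpace ℝ (Fin n)) x).left_inv hq]
  exact (h3.congr_of_eventuallyEq h4.symm).fderiv

/-- Step (5): the chart-change derivative `tangentCoordChange (𝓡 n) y x y` is invertible (its
inverse is `tangentCoordChange (𝓡 n) x y y`, by the cocycle identity `tangentCoordChange_comp` and
`tangentCoordChange_self`), so its determinant is nonzero. [folklore] -/
theorem det_tangentCoordChange_ne_zero {x y : sphere (0 : EuclideanSpace ℝ (Fin (n + 1))) 1}
    (hy : y ∈ (chartAt (EuclideanSpace ℝ (Fin n)) x).source) :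
    LinearMap.det ((tangentCoordChange (𝓡 n) y x y :
        EuclideanSpace ℝ (Fin n) →L[ℝ] EuclideanSpace ℝ (Fin n)) :
          EuclideanSpace ℝ (Fin n) →ₗ[ℝ] EuclideanSpace ℝ (Fin n)) ≠ 0 := by
  have hyy : y ∈ (extChartAt (𝓡 n) y).source := by simp
  have hyx : y ∈ (extChartAt (𝓡 n) x).source := by simpa using hy
  have : ((tangentCoordChange (𝓡 n) y x y :
        EuclideanSpace ℝ (Fin n) →L[ℝ] EuclideanSpace ℝ (Fin n)) :
          EuclideanSpace ℝ (Fin n) →ₗ[ℝ] EuclideanSpace ℝ (Fin n)) ∘ₗ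
      ((tangentCoordChange (𝓡 n) x y y :
        EuclideanSpace ℝ (Fin n) →L[ℝ] EuclideanSpace ℝ (Fin n)) :
          EuclideanSpace ℝ (Fin n) →ₗ[ℝ] EuclideanSpace ℝ (Fin n)) = LinearMap.id := by
    refine LinearMap.ext fun v => ?_
    rw [LinearMap.comp_apply, ContinuousLinearMap.coe_coe, ContinuousLinearMap.coe_coe,
      tangentCoordChange_comp ⟨⟨hyx, hyy⟩, hyx⟩, tangentCoordChange_self hyx]
    rfl
  have h := congrArg LinearMap.det this
  rw [LinearMap.det_comp, LinearMap.det_id] at h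
  intro h0
  rw [h0, zero_mul] at h
  exact zero_ne_one h

/-! #### The frame determinant `Φₓ(q) = det[σₓ⁻¹ q, D(σₓ⁻¹)(q) e₁, …, D(σₓ⁻¹)(q) eₙ]`

To keep this proof file free of auxiliary definitions, the frame determinant enters the next
lemmas as a function `Φ` together with its defining equation `hΦ`. -/

variable {Φ : sphere (0 : EuclideanSpace ℝ (Fin (n + 1))) 1 → EuclideanSpace ℝ (Fin n) → ℝ}

/-- Step (2): the frame determinant `Φₓ` of the chart at `x` is continuous on the model space (the
inverse chart `σₓ⁻¹` is `C¹` and the determinant is continuous). [folklore] -/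
theorem continuous_frameDet
    (hΦ : ∀ x q, Φ x q = (EuclideanSpace.basisFun (Fin (n + 1)) ℝ).toBasis.det
      (Fin.cons ((chartAt (EuclideanSpace ℝ (Fin n)) x).symm q : EuclideanSpace ℝ (Fin (n + 1)))
        fun i => fderiv ℝ (Subtype.val ∘ (chartAt (EuclideanSpace ℝ (Fin n)) x).symm) q
          ((EuclideanSpace.basisFun (Fin n) ℝ).toBasis i)))
    (x : sphere (0 : EuclideanSpace ℝ (Fin (n + 1))) 1) : Continuous fun q => Φ x q := by
  simp only [hΦ]
  have h1 := (contDiff_coe_comp_chartAt_symm x).continuous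
  have h2 := (contDiff_coe_comp_chartAt_symm x).continuous_fderiv one_ne_zero
  refine (continuous_basisFun_det (n + 1)).comp (continuous_pi fun j => ?_)
  refine Fin.cases ?_ (fun i => ?_) j
  · simp only [Fin.cons_zero]
    exact h1
  · simp only [Fin.cons_succ]
    exact h2.clm_apply continuous_const

/-- Step (1): `Φₓ(σₓ x) ≠ 0`, since `D(σₓ⁻¹)(σₓ x) = mfderiv val x` is injective with range `xᗮ`
(Mathlib `mfderiv_coe_sphere_injective`, `range_mfderiv_coe_sphere`) and `x ∉ xᗮ`. [folklore] -/
theorem frameDet_chartAt_self_ne_zero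
    (hΦ : ∀ x q, Φ x q = (EuclideanSpace.basisFun (Fin (n + 1)) ℝ).toBasis.det
      (Fin.cons ((chartAt (EuclideanSpace ℝ (Fin n)) x).symm q : EuclideanSpace ℝ (Fin (n + 1)))
        fun i => fderiv ℝ (Subtype.val ∘ (chartAt (EuclideanSpace ℝ (Fin n)) x).symm) q
          ((EuclideanSpace.basisFun (Fin n) ℝ).toBasis i)))
    (x : sphere (0 : EuclideanSpace ℝ (Fin (n + 1))) 1) :
    Φ x (chartAt (EuclideanSpace ℝ (Fin n)) x x) ≠ 0 := by
  haveI : Fact (finrank ℝ (EuclideanSpace ℝ (Fin (n + 1))) = n + 1) := ⟨finrank_euclideanSpace_fin⟩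
  have hx : ((chartAt (EuclideanSpace ℝ (Fin n)) x).symm (chartAt (EuclideanSpace ℝ (Fin n)) x x) :
      EuclideanSpace ℝ (Fin (n + 1))) = x := by
    rw [(chartAt (EuclideanSpace ℝ (Fin n)) x).left_inv (mem_chart_source _ x)]
  rw [hΦ, ← mfderiv_coe_sphere_eq_fderiv, hx]
  exact basisFun_det_cons_ne_zero x _
    (mfderiv_coe_sphere_injective (E := EuclideanSpace ℝ (Fin (n + 1))) (n := n) x)
    (range_mfderiv_coe_sphere (E := EuclideanSpace ℝ (Fin (n + 1))) (n := n) x)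

/-- Steps (3)+(4): for `y` in the chart domain of `x`, the frame determinants of the two charts at
the point `y` differ by the Jacobian determinant of the chart change,
`Φ_y(σ_y y) = det (tangentCoordChange (𝓡 n) y x y) · Φₓ(σₓ y)`. [folklore] -/
theorem frameDet_eq_det_mul
    (hΦ : ∀ x q, Φ x q = (EuclideanSpace.basisFun (Fin (n + 1)) ℝ).toBasis.det
      (Fin.cons ((chartAt (EuclideanSpace ℝ (Fin n)) x).symm q : EuclideanSpace ℝ (Fin (n + 1)))
        fun i => fderiv ℝ (Subtype.val ∘ (chartAt (EuclideanSpace ℝ (Fin n)) x).symm) q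
          ((EuclideanSpace.basisFun (Fin n) ℝ).toBasis i)))
    {x y : sphere (0 : EuclideanSpace ℝ (Fin (n + 1))) 1}
    (hy : y ∈ (chartAt (EuclideanSpace ℝ (Fin n)) x).source) :
    Φ y (chartAt (EuclideanSpace ℝ (Fin n)) y y) =
      LinearMap.det ((tangentCoordChange (𝓡 n) y x y :
        EuclideanSpace ℝ (Fin n) →L[ℝ] EuclideanSpace ℝ (Fin n)) :
          EuclideanSpace ℝ (Fin n) →ₗ[ℝ] EuclideanSpace ℝ (Fin n)) *
        Φ x (chartAt (EuclideanSpace ℝ (Fin n)) x y) := by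
  simp only [hΦ]
  rw [fderiv_coe_comp_chartAt_symm_eq_comp hy, det_cons_comp_eq_det_mul]
  congr 2
  simp only [(chartAt (EuclideanSpace ℝ (Fin n)) x).left_inv hy,
    (chartAt (EuclideanSpace ℝ (Fin n)) y).left_inv (mem_chart_source _ y)]

/-- Steps (1)+(2): near `x`, the frame determinant `Φₓ(σₓ y)` of the chart at `x` is nonzero and
has the same sign as at `y = x` (continuity of `Φₓ ∘ σₓ` at `x` and `Φₓ(σₓ x) ≠ 0`). [folklore] -/
theorem eventually_frameDet_pos_iff
    (hΦ : ∀ x q, Φ x q = (EuclideanSpace.basisFun (Fin (n + 1)) ℝ).toBasis.det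
      (Fin.cons ((chartAt (EuclideanSpace ℝ (Fin n)) x).symm q : EuclideanSpace ℝ (Fin (n + 1)))
        fun i => fderiv ℝ (Subtype.val ∘ (chartAt (EuclideanSpace ℝ (Fin n)) x).symm) q
          ((EuclideanSpace.basisFun (Fin n) ℝ).toBasis i)))
    (x : sphere (0 : EuclideanSpace ℝ (Fin (n + 1))) 1) :
    ∀ᶠ y in 𝓝 x, Φ x (chartAt (EuclideanSpace ℝ (Fin n)) x y) ≠ 0 ∧
      (0 < Φ x (chartAt (EuclideanSpace ℝ (Fin n)) x y) ↔
        0 < Φ x (chartAt (EuclideanSpace ℝ (Fin n)) x x)) := by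
  have hc : ContinuousAt (fun y => Φ x (chartAt (EuclideanSpace ℝ (Fin n)) x y)) x :=
    (continuous_frameDet hΦ x).continuousAt.comp
      ((chartAt (EuclideanSpace ℝ (Fin n)) x).continuousAt (mem_chart_source _ x))
  rcases Ne.lt_or_gt (frameDet_chartAt_self_ne_zero hΦ x) with h | h
  · filter_upwards [hc.eventually (Iio_mem_nhds h)] with y hy
    exact ⟨ne_of_lt hy, iff_of_false (lt_asymm hy) (lt_asymm h)⟩
  · filter_upwards [hc.eventually (Ioi_mem_nhds h)] with y hy
    exact ⟨ne_of_gt hy, iff_of_true hy h⟩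

/-! #### Sign bookkeeping -/

/-- Elementary sign bookkeeping: for nonzero reals `a`, `d` and `b` with the same strict sign as
`a`, `d · a` has the sign of `b` iff `d > 0`. [folklore] -/
theorem mul_pos_iff_iff_pos {a b d : ℝ} (ha : a ≠ 0) (hd : d ≠ 0) (hab : 0 < a ↔ 0 < b) :
    ((0 < d * a ↔ 0 < b) ↔ 0 < d) := by
  rw [← hab]
  rcases Ne.lt_or_gt ha with ha | ha <;> rcases Ne.lt_or_gt hd with hd | hd
  · have h1 : 0 < d * a := mul_pos_of_neg_of_neg hd ha
    exact ⟨fun h => ((lt_asymm ha) (h.1 h1)).elim, fun h => ((lt_asymm hd) h).elim⟩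
  · have h1 : ¬ 0 < d * a := lt_asymm (mul_neg_of_pos_of_neg hd ha)
    exact ⟨fun _ => hd, fun _ => ⟨fun h => (h1 h).elim, fun h => ((lt_asymm ha) h).elim⟩⟩
  · have h1 : ¬ 0 < d * a := lt_asymm (mul_neg_of_neg_of_pos hd ha)
    exact ⟨fun h => (h1 (h.2 ha)).elim, fun h => ((lt_asymm hd) h).elim⟩
  · exact ⟨fun _ => hd, fun _ => ⟨fun _ => ha, fun _ => mul_pos hd ha⟩⟩

/-- Two sign-choices `±o` of an element with `o ≠ -o` agree iff the deciding propositions are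
equivalent. [folklore] -/
theorem ite_neg_eq_ite_neg_iff {α : Type*} [Neg α] {o : α} (ho : o ≠ -o) (P Q : Prop)
    [Decidable P] [Decidable Q] :
    ((if P then o else -o) = (if Q then o else -o)) ↔ (P ↔ Q) := by
  by_cases hP : P <;> by_cases hQ : Q <;> simp [hP, hQ, ho, ho.symm]

end SmoothOrientation.Sphere

/-! #### The standard orientation of `𝕊ⁿ` and the discharge of `isOrientable_sphere` -/

open SmoothOrientation.Sphere in
/-- The **standard smooth orientation of the sphere `𝕊ⁿ`** (`n : ℕ`, including `𝕊⁰`), the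
boundary orientation of `𝕊ⁿ = ∂Dⁿ⁺¹` ("outward normal first") read in Mathlib's stereographic
charts: there is a smooth orientation of `𝕊ⁿ` whose value at `x` is the standard orientation
`euclideanOrientation n` of the model space if the chart `σₓ` at `x` is positively oriented at `x`,
i.e. if the frame determinant `Φₓ(σₓ x) = det[x, D(σₓ⁻¹)(σₓ x) e₁, …, D(σₓ⁻¹)(σₓ x) eₙ]` is
positive, and `-euclideanOrientation n` otherwise. Local constancy (`eventually_eq_iff'`): for `y`
near `x`, `o y = o x ↔ (0 < det T · Φₓ(σₓ y) ↔ 0 < Φₓ(σₓ x)) ↔ 0 < det T` by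
`frameDet_eq_det_mul`, `eventually_frameDet_pos_iff` and `det_tangentCoordChange_ne_zero`
(Hirsch, *Differential Topology*, §4.4, p. 101: `Sⁿ = ∂Dⁿ⁺¹`; §5.1, p. 115: the standard
orientation of `Sⁿ`). [cite: HirschDT1976, §4.4 p. 101 and §5.1 p. 115] -/
theorem exists_smoothOrientation_sphere (n : ℕ) :
    ∃ o : SmoothOrientation (𝓡 n) (sphere (0 : EuclideanSpace ℝ (Fin (n + 1))) 1),
      ∀ x : sphere (0 : EuclideanSpace ℝ (Fin (n + 1))) 1, o x =
        if 0 < (EuclideanSpace.basisFun (Fin (n + 1)) ℝ).toBasis.det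
            (Fin.cons (x : EuclideanSpace ℝ (Fin (n + 1))) fun i =>
              fderiv ℝ (Subtype.val ∘ (chartAt (EuclideanSpace ℝ (Fin n)) x).symm)
                (chartAt (EuclideanSpace ℝ (Fin n)) x x) ((EuclideanSpace.basisFun (Fin n) ℝ).toBasis i))
        then euclideanOrientation n else -euclideanOrientation n := by
  set Φ : sphere (0 : EuclideanSpace ℝ (Fin (n + 1))) 1 → EuclideanSpace ℝ (Fin n) → ℝ :=
    fun x q => (EuclideanSpace.basisFun (Fin (n + 1)) ℝ).toBasis.det
      (Fin.cons ((chartAt (EuclideanSpace ℝ (Fin n)) x).symm q : EuclideanSpace ℝ (Fin (n + 1)))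
        fun i => fderiv ℝ (Subtype.val ∘ (chartAt (EuclideanSpace ℝ (Fin n)) x).symm) q
          ((EuclideanSpace.basisFun (Fin n) ℝ).toBasis i))
  have hΦ : ∀ x q, Φ x q = (EuclideanSpace.basisFun (Fin (n + 1)) ℝ).toBasis.det
      (Fin.cons ((chartAt (EuclideanSpace ℝ (Fin n)) x).symm q : EuclideanSpace ℝ (Fin (n + 1)))
        fun i => fderiv ℝ (Subtype.val ∘ (chartAt (EuclideanSpace ℝ (Fin n)) x).symm) q
          ((EuclideanSpace.basisFun (Fin n) ℝ).toBasis i)) := fun x q => rfl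
  refine ⟨⟨fun x => if 0 < Φ x (chartAt (EuclideanSpace ℝ (Fin n)) x x) then euclideanOrientation n
      else -euclideanOrientation n, fun x => ?_⟩, fun x => ?_⟩
  · filter_upwards [chart_source_mem_nhds (EuclideanSpace ℝ (Fin n)) x,
      eventually_frameDet_pos_iff hΦ x] with y hy hsgn
    beta_reduce
    rw [ite_neg_eq_ite_neg_iff (Module.Ray.ne_neg_self _), frameDet_eq_det_mul hΦ hy]
    exact mul_pos_iff_iff_pos hsgn.1 (det_tangentCoordChange_ne_zero hy) hsgn.2
  · show (if 0 < Φ x (chartAt (EuclideanSpace ℝ (Fin n)) x x) then euclideanOrientation n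
      else -euclideanOrientation n) = _
    rw [hΦ, (chartAt (EuclideanSpace ℝ (Fin n)) x).left_inv (mem_chart_source _ x)]

/-- **Spheres are orientable**: discharge of the named fact `Literature.Topology.FourManifolds.isOrientable_sphere`, witnessed by
the standard orientation of `𝕊ⁿ = ∂Dⁿ⁺¹` (`exists_smoothOrientation_sphere`; Hirsch,
*Differential Topology*, §4.4, p. 101: "`Sⁿ = ∂Dⁿ⁺¹`" is oriented as a boundary; §5.1, p. 115: the
standard orientation of `Sⁿ`). [cite: HirschDT1976, §4.4 p. 101 and §5.1 p. 115] -/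
theorem isOrientable_sphere_holds : isOrientable_sphere := fun n =>
  (exists_smoothOrientation_sphere n).nonempty

end Literature.Topology.FourManifolds
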